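import Summits.CriticalPhenomena.PercolationContinuityZ3.Theorems.PercNearOneGluingNoHeavyQuantSliceLamColumns
import Summits.CriticalPhenomena.PercolationContinuityZ3.Theorems.PercNearOneGluingNoHeavyQuantBandTwoBlobDEC
import HarnessLib

/-!
# QUANT lane R8, T-DEC: **SL-λ\* AT `g ≥ 1/2` IS A THEOREM, AND SO IS THE `g ≥ 1/2` HALF OF `LawDec.SliceClosedAll`** — Theorem E with its
# band hypothesis discharged by the typer's kernel theorem `bandTwoBlobDEC_holds` (THEOREM E\*), the conjecture's own `λ*` form, and the
# all-layers corollary (LEAD-NOTES-G23 N52 (3′)–(3‴))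

builds on p205010 (kernel theorem, internal audit signed; external expert review pending)

Support file (`--supports stmt-CriticalPhenomena-4575`), QUANT lane lead seat prim-quant-lead (gen 23), rung R8 of
`run/shared/lean/prim/quant/LADDER.md`.  Theorems only; standard axioms, no sorries; UNCONDITIONAL (the band piece `LawDec.BandTwoBlobDEC` —
census-1 g19's local lemma in two-blob form — is the typer g24's kernel theorem `bandTwoBlobDEC_holds`, `…QuantBandTwoBlobDEC`, p311828).
* `slice_TP_eq_shift_law2` — the slice of a two-point law `{l, h; γ}` is the two-blob law `LAW2[h − l, γ; a, g]` translated by `l`;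
* **`slice_decAtT_of_bandTwoBlobDEC`** (THEOREM E\*, stated with `BandTwoBlobDEC` as an explicit hypothesis to display the dependency) —
  Theorem E (`slice_decAtT_of_lamColumns`) with `hband` discharged: per charged cheap band pair, `BandTwoBlobDEC` at sizes `b = h − l`, `a`,
  layer `j′ − l ≥ a`, target `bρ + ag = T′ − 2l` (band condition ⟺ `2h ≤ T′`), translated by `l` with census-2's `decAtT_shift_two` and
  enlarged with `decAtT_mono_top`;
* **`slice_decAtT_lamStar`** / **`slice_decAtT_noWindowMid`** — CONJECTURE SL-λ\* (README V253) at every floor `x ≥ 1/2`, now a THEOREM, in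
  its own form: `m₀` the least charged true window mid at `T + ag`, `λ* = m₀ − 1` (or no such mid and `λ* = j′`, when `DEC(T, j′)` alone
  suffices); Theorem E's support hypotheses are derived from the definition of `λ*`;
* **`slice_decAt_of_forall_layers_half`** — THE `g ≥ 1/2` HALF OF THE STATEMENT OF RECORD `LawDec.SliceClosedAll` (README V254): for every
  probability law DEC at every layer (at its mean), every `0 < x ≤ g < 1` with `g ≥ 1/2` and every `a ≥ 1`, the slice is DEC at every layer
  `j′` (small layers by census-2's `slice_decAt_of_lt`; only the layers `j′` and `λ*` of the hypothesis are used; no top-affordability).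
So (README V270): **`SliceClosedAll ∧ (g ≥ 1/2)` is a kernel theorem**; open at the law level: `g < 1/2`.

[this work]; nothing here is cited as a published result.  The gluing rows served [cite: KozmaNitzan2024, Conjecture 3 (p. 15)]; product
measure [cite: Grimmett1999, §1.3 p. 10].
-/

noncomputable section

namespace Summit.CriticalPhenomena.PercolationContinuityZ3.Theorems

namespace Quant

open Finset

/-- the two-point law `{lo, hi; g}` (as in `…QuantLawDEC`) -/
local notation3 "TP[" lo ", " hi ", " g ", " h "]" =>
  (g : ℝ) * (if (h : ℕ) = (hi : ℕ) then (1 : ℝ) else 0) + (1 - (g : ℝ)) * (if (h : ℕ) = (lo : ℕ) then (1 : ℝ) else 0)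

/-- the two-blob law (as in `…QuantBandTwoBlobFlow`) -/
local notation3 "LAW2[" a ", " u ", " b ", " v ", " h "]" =>
  (1 - (u : ℝ)) * (1 - (v : ℝ)) * (if (h : ℕ) = 0 then (1 : ℝ) else 0)
    + (u : ℝ) * (1 - (v : ℝ)) * (if (h : ℕ) = (a : ℕ) then (1 : ℝ) else 0)
    + (1 - (u : ℝ)) * (v : ℝ) * (if (h : ℕ) = (b : ℕ) then (1 : ℝ) else 0)
    + (u : ℝ) * (v : ℝ) * (if (h : ℕ) = (a : ℕ) + (b : ℕ) then (1 : ℝ) else 0)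

namespace LawDec

/-! ### Theorem E\* and SL-λ\* (LEAD-NOTES-G23 N52 (3′)) -/

section LamStar

variable (x T g : ℝ) (j' M a lam : ℕ) (ν : ℕ → ℝ)

/-- the slice of a two-point law `{l, h; γ}` is the two-blob law `LAW2[h − l, γ; a, g]` translated by `l`. [this work] -/
theorem slice_TP_eq_shift_law2 (l h aa : ℕ) (γ gg : ℝ) (hlh : l ≤ h) :
    slice (fun t => TP[l, h, γ, t]) aa gg = fun k => if l ≤ k then LAW2[h - l, γ, aa, gg, k - l] else 0 := by
  funext k
  rw [slice_TP]
  by_cases hk : l ≤ k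
  · rw [if_pos hk]
    have e1 : (k - l = 0) ↔ (k = l) := by omega
    have e2 : (k - l = h - l) ↔ (k = h) := by omega
    have e3 : (k - l = aa) ↔ (k = l + aa) := by omega
    have e4 : (k - l = (h - l) + aa) ↔ (k = h + aa) := by omega
    simp only [e1, e2, e3, e4]
    ring
  · rw [if_neg hk, if_neg (by omega), if_neg (by omega), if_neg (by omega), if_neg (by omega)]
    ring

/-- **THEOREM E\* (lead g23, N52 (3)): SL-λ AT `g ≥ 1/2` FOR EVERY SUPPORT, CONDITIONAL ON THE TYPER'S `LawDec.BandTwoBlobDEC`.**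
Theorem E with its band hypothesis discharged from census-1 g19's BAND PIECE in the typer's two-blob form (`…QuantBandTwoBlobFlow`,
`@[conjecture]`, status open): for a charged cheap band pair `{l, h; γ}` (`γ = pairGate = x² + (1−x)ρ`, `ρ = (T − 2l)/(h − l) < x`) the
conjecture at sizes `b = h − l`, `a`, layer `j′ − l ≥ a` and target `bρ + ag = T′ − 2l` (band condition `b(2 − ρ) ≤ ag ⟺ 2h ≤ T′`) gives
the two-blob law, which census-2's shift lemma `decAtT_shift_two` translates by `l` onto the slice of the pair (`slice_TP_eq_shift_law2`).
CONDITIONAL RESULT: the hypothesis `hBand : BandTwoBlobDEC` is a named open statement of this lane (not a published fact); when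
`bandTwoBlobDEC_holds` lands, SL-λ* at every floor `x ≥ 1/2` is a theorem (the support hypotheses are automatic for `λ = λ*`). [this work] -/
theorem slice_decAtT_of_bandTwoBlobDEC (hBand : BandTwoBlobDEC) (hx0 : 0 < x) (hx1 : x < 1) (hxg : x ≤ g) (hg1 : g ≤ 1)
    (hg2 : 1 / 2 ≤ g) (ha : 1 ≤ a) (haj : a ≤ j') (hν : ∀ k, 0 ≤ ν k) (hνM : ∀ k, M < k → ν k = 0)
    (hν1 : ∑ h ∈ Finset.range (M + 1), ν h = 1)
    (hdj : DECAtT x T j' M ν) (hdl : DECAtT x T lam M ν) (hlamj : lam ≤ j') (hlam : j' ≤ lam + a)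
    (hbelow : ∀ k, k ≤ lam → T ≤ 2 * (k : ℝ) → ν k ≠ 0 → 2 * (k : ℝ) ≤ T + (a : ℝ) * g ∨ k + a ≤ j')
    (habove : ∀ k, lam < k → k ≤ j' → ν k ≠ 0 → T + (a : ℝ) * g < 2 * (k : ℝ)) :
    DECAtT x (T + (a : ℝ) * g) j' (M + a) (slice ν a g) := by
  refine slice_decAtT_of_lamColumns x T g j' M a lam ν hx0 hx1 hxg hg1 hg2 ha haj hν hνM hν1 hdj hdl hlamj hlam hbelow habove ?_
  intro l h hlh _ hla hlow _ h2h _ hcheap _ hνh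
  have hhM : h ≤ M := by
    by_contra hc; exact hνh (hνM h (not_le.1 hc))
  have hml : (0:ℝ) < (h:ℝ) - l := by
    have : (l:ℝ) < h := by exact_mod_cast hlh
    linarith
  have h1x : (0:ℝ) < 1 - x := by linarith
  set ρ := (T - 2 * (l : ℝ)) / ((h : ℝ) - l) with hρ
  have hγ : pairGate x T l h = max ρ (x ^ 2 + (1 - x) * ρ) := rfl
  have hρx : ρ < x := lt_of_le_of_lt (by rw [hγ]; exact le_max_left _ _) hcheap
  have hρ0 : 0 < ρ := div_pos (by linarith) hml
  have hγeq : pairGate x T l h = x ^ 2 + (1 - x) * ρ := by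
    rw [hγ]; refine max_eq_right ?_; nlinarith
  have hρ' : (pairGate x T l h - x ^ 2) / (1 - x) = ρ := by
    rw [hγeq]; field_simp; ring
  have hγlo : x ^ 2 < pairGate x T l h := by rw [hγeq]; nlinarith
  set b : ℕ := h - l with hb
  have hb1 : 1 ≤ b := by omega
  have hbR : (b : ℝ) = (h : ℝ) - l := by rw [hb, Nat.cast_sub hlh.le]
  have hbρ : (b : ℝ) * ρ = T - 2 * (l : ℝ) := by rw [hbR, hρ, mul_div_cancel₀ _ hml.ne']
  have hcond : (b : ℝ) * (2 - (pairGate x T l h - x ^ 2) / (1 - x)) ≤ (a : ℝ) * g := by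
    rw [hρ', mul_sub, hbρ, hbR]; linarith
  -- the typer's conjecture at layer `j′ − l`, translated by `l`, with the top enlarged
  have hB := hBand x (pairGate x T l h) g a b (j' - l) hx0 hx1 hγlo hcheap hxg hg1 ha hb1 (by omega) hcond
  rw [hρ'] at hB
  have hS := decAtT_shift_two x _ (j' - l) (b + a) l _ hB
  have eT : (b : ℝ) * ρ + (a : ℝ) * g + 2 * (l : ℝ) = T + (a : ℝ) * g := by rw [hbρ]; ring
  have ej : j' - l + l = j' := by omega
  have eM : b + a + l = h + a := by omega
  rw [eT, ej, eM] at hS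
  rw [slice_TP_eq_shift_law2 l h a _ g hlh.le]
  exact decAtT_mono_top hS (by omega)

/-- **SL-λ\* AT `g ≥ 1/2` IN THE CONJECTURE'S OWN FORM — A THEOREM** (README V253/V269; the band piece is the typer's KERNEL theorem
`bandTwoBlobDEC_holds`, p311828): probability law `ν`
on `{0..M}`, `0 < x < 1`, `1 ≤ a ≤ j′`, `x ≤ g ≤ 1`, `1/2 ≤ g`; `m₀` the least charged TRUE WINDOW MID at the raised target (`m₀ ≤ j′ <
m₀ + a`, `T + ag < 2m₀`, minimal among such charged atoms), `λ* = m₀ − 1`.  THEN `DECAtT x T j′ M ν ∧ DECAtT x T λ* M ν ⟹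
DECAtT x (T + ag) j′ (M + a) (slice ν a g)`.  The two support hypotheses of Theorem E hold automatically at `λ*`. [this work] -/
theorem slice_decAtT_lamStar (m₀ : ℕ) (hx0 : 0 < x) (hx1 : x < 1) (hxg : x ≤ g)
    (hg1 : g ≤ 1) (hg2 : 1 / 2 ≤ g) (ha : 1 ≤ a) (haj : a ≤ j') (hν : ∀ k, 0 ≤ ν k) (hνM : ∀ k, M < k → ν k = 0)
    (hν1 : ∑ h ∈ Finset.range (M + 1), ν h = 1)
    (hm₀j : m₀ ≤ j') (hm₀a : j' < m₀ + a) (hm₀t : T + (a : ℝ) * g < 2 * (m₀ : ℝ))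
    (hmin : ∀ k, k ≤ j' → j' < k + a → ν k ≠ 0 → T + (a : ℝ) * g < 2 * (k : ℝ) → m₀ ≤ k)
    (hdj : DECAtT x T j' M ν) (hdl : DECAtT x T (m₀ - 1) M ν) :
    DECAtT x (T + (a : ℝ) * g) j' (M + a) (slice ν a g) := by
  refine slice_decAtT_of_bandTwoBlobDEC x T g j' M a (m₀ - 1) ν bandTwoBlobDEC_holds hx0 hx1 hxg hg1 hg2 ha haj hν hνM hν1
    hdj hdl (by omega) (by omega) (fun k hk _ hne => ?_) (fun k hk hkj _ => ?_)
  · by_cases h1 : k + a ≤ j'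
    · exact Or.inr h1
    · refine Or.inl (not_lt.1 fun h2 => ?_)
      have := hmin k (by omega) (by omega) hne h2
      omega
  · have hmk : (m₀ : ℝ) ≤ k := by exact_mod_cast (show m₀ ≤ k by omega)
    linarith

/-- **SL-λ\* AT `g ≥ 1/2`, NO TRUE WINDOW MID** (`λ* = j′`): if no charged atom `k` with `j′ − a < k ≤ j′` is a true mid at `T + ag`,
then `DECAtT x T j′ M ν` ALONE gives the slice (`g ≥ 1/2`; unconditional). [this work] -/
theorem slice_decAtT_noWindowMid (hx0 : 0 < x) (hx1 : x < 1) (hxg : x ≤ g)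
    (hg1 : g ≤ 1) (hg2 : 1 / 2 ≤ g) (ha : 1 ≤ a) (haj : a ≤ j') (hν : ∀ k, 0 ≤ ν k) (hνM : ∀ k, M < k → ν k = 0)
    (hν1 : ∑ h ∈ Finset.range (M + 1), ν h = 1)
    (hnone : ∀ k, k ≤ j' → j' < k + a → ν k ≠ 0 → 2 * (k : ℝ) ≤ T + (a : ℝ) * g)
    (hdj : DECAtT x T j' M ν) :
    DECAtT x (T + (a : ℝ) * g) j' (M + a) (slice ν a g) := by
  refine slice_decAtT_of_bandTwoBlobDEC x T g j' M a j' ν bandTwoBlobDEC_holds hx0 hx1 hxg hg1 hg2 ha haj hν hνM hν1 hdj hdj le_rfl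
    (Nat.le_add_right _ _) (fun k hk _ hne => ?_) (fun k hk hkj _ => absurd hkj (by omega))
  by_cases h1 : k + a ≤ j'
  · exact Or.inr h1
  · exact Or.inl (hnone k hk (by omega) hne)

/-- **THE `g ≥ 1/2` HALF OF THE LAW-LEVEL STATEMENT OF RECORD IS A THEOREM.**  `LawDec.SliceClosedAll` (README V254;
`…QuantSliceClosedAllLayers`, `@[conjecture]`) restricted to gates `g ≥ 1/2` — and without its top-affordability and `j′ < M + a`
hypotheses — HOLDS (the band piece being the typer's kernel theorem `bandTwoBlobDEC_holds`): for a probability law `μ` on `{0..M}`,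
`0 < x ≤ g < 1`, `1/2 ≤ g`, `a ≥ 1`, if `μ` is
DEC(i) at floor `x` (at its mean) for EVERY layer `i`, then `slice μ a g` is DEC(j′) for every `j′`.  Layers `j′ < a`: census-2's
`slice_decAt_of_lt` (unconditional); `j′ ≥ a`: THEOREM E\* at `λ* = m₀ − 1` for the least charged true window mid `m₀` at the raised mean
(`slice_decAtT_lamStar`), or at `λ* = j′` if there is none (`slice_decAtT_noWindowMid`); only the two
layers `j′` and `λ*` of the hypothesis are used. [this work] -/
theorem slice_decAt_of_forall_layers_half (xx gg : ℝ) (MM aa jj : ℕ) (μ : ℕ → ℝ)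
    (hx0 : 0 < xx) (hxg : xx ≤ gg) (hg1 : gg < 1) (hg2 : 1 / 2 ≤ gg) (ha : 1 ≤ aa)
    (hμ0 : ∀ h, 0 ≤ μ h) (hμM : ∀ h, MM < h → μ h = 0) (hμ1 : ∑ h ∈ Finset.range (MM + 1), μ h = 1)
    (hdec : ∀ i, DECAt xx i MM μ) :
    DECAt xx jj (MM + aa) (slice μ aa gg) := by
  classical
  by_cases hja : jj < aa
  · exact slice_decAt_of_lt xx gg MM aa jj μ hx0 hxg hg1 hμ0 hμM hμ1 hja
  have hx1 : xx < 1 := lt_of_le_of_lt hxg hg1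
  set T : ℝ := ∑ h ∈ Finset.range (MM + 1), (h : ℝ) * μ h with hT
  have hdecT : ∀ i, DECAtT xx T i MM μ := fun i => (decAt_iff_decAtT xx i MM μ).1 (hdec i)
  have key : DECAtT xx (T + (aa : ℝ) * gg) jj (MM + aa) (slice μ aa gg) := by
    by_cases hex : ∃ k, k ≤ jj ∧ jj < k + aa ∧ μ k ≠ 0 ∧ T + (aa : ℝ) * gg < 2 * (k : ℝ)
    · obtain ⟨hk, hka, hne, ht⟩ := Nat.find_spec hex
      exact slice_decAtT_lamStar xx T gg jj MM aa μ (Nat.find hex) hx0 hx1 hxg hg1.le hg2 ha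
        (not_lt.1 hja) hμ0 hμM hμ1 hk hka ht (fun k hk' hka' hne' ht' => Nat.find_min' hex ⟨hk', hka', hne', ht'⟩)
        (hdecT jj) (hdecT _)
    · push Not at hex
      exact slice_decAtT_noWindowMid xx T gg jj MM aa μ hx0 hx1 hxg hg1.le hg2 ha (not_lt.1 hja)
        hμ0 hμM hμ1 (fun k hk hka hne => hex k hk hka hne) (hdecT jj)
  rw [decAt_iff_decAtT, sum_mul_slice μ aa gg MM hμM hμ1]
  exact key

end LamStar

end LawDec

end Quant

end Summit.CriticalPhenomena.PercolationContinuityZ3.Theorems
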